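import Mathlib.Analysis.Complex.Basic
import Mathlib.Analysis.Calculus.Deriv.Basic
import Mathlib.Analysis.Calculus.FDeriv.Basic
import Mathlib.MeasureTheory.Integral.Bochner.Basic
import Mathlib.MeasureTheory.Measure.Lebesgue.Basic
import Literature.NumberTheory.Transcendental.NashCubes
import Literature.NumberTheory.Transcendental.KZSemialgebraicComplex
import HarnessLib

/-!
# Loaded cubical chains on the complement of Terasoma's three lines

Definition request `defn-KZ.LoadedCubicalChains` (topic `Literature/NumberTheory/Transcendental`;
crux `MultiplicationThree` = item `stmt-KontsevichZagierPeriods-3598`, line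
`rank-one-period-injectivity`, whose registered stubs `BoxEnd`, `BentSquareCycle`,
`PeriodInjectivity`, `CubicalStokes` are stated over this vocabulary). ROUTE-POSITED NOTION (like
`KZ.unfoldedStokesRel`): the file fixes, as real definitions with bodies and nothing asserted, the
language in which the line compares the periods of two *loaded* (twisted) semialgebraic `2`-cycles
for ONE rank-one local system and moves between them by Stokes' formula on loaded `3`-cubes.

## The setting

* **Terasoma's arrangement** [Otsubo–Yamazaki 2026, §7.2, proof of Thm. 7.2, after Terasoma 1995]:
  in the proof of the motivic multiplication formula the curve power `C^{n-1}` maps to the torus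
  cover of the hyperplane `S = {s₁ + ⋯ + sₙ = n, s₁⋯sₙ ≠ 0}` by `sᵢ = ∏ⱼ (1 − ζⁱ yⱼ)`, `ζ` a
  primitive `n`-th root of unity. For `n = 3`, in the elementary symmetric coordinates
  `e₁ = y₁ + y₂`, `e₂ = y₁ y₂` of `Sym² 𝔸¹ = 𝔸²`, these are the three lines in general position
  `s_j = 1 − ζʲ e₁ + ζ²ʲ e₂` (`j = 0, 1, 2`; `KZ.sLine`), with
  `s₀ s₁ s₂ = (1 − y₁³)(1 − y₂³) = 1 − e₁³ + 3 e₁ e₂ + e₂³` (`KZ.fArr`, `KZ.fArr_eq_prod_sLine`),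
  and `U = {s₀ s₁ s₂ ≠ 0} ⊆ ℂ²` (`KZ.U`) is their complement. Points of `ℂ²` are recorded by FOUR
  REAL *Eisenstein coordinates* `p ↦ (p₀ + ζ p₁, p₂ + ζ p₃)` (`KZ.eis`), i.e. coordinates with
  respect to the basis `{1, ζ}` of `ℤ[ζ]`, so that the `ℚ(ζ)`-linear maps of the line (the bent
  square `Sym(ζᵐ u, ζᵐ' v)`, …) are `ℚ`-polynomial maps `ℝᵏ → ℝ⁴` and the Kontsevich–Zagier
  calculus over `ℚ` (`KZCalculus.lean`) applies to real and imaginary parts.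
* **Loaded chains** [Aomoto–Kita 2011, §2.1.5–§2.1.7]: for the multivalued function
  `f^{s-1}`, `f = s₀s₁s₂`, `s ∈ ℚ`, the twisted chain group has basis the cells `Δ ⊗ (branch of
  f^{s-1} on Δ)`, and the twisted boundary `∂_ω (Δ ⊗ β) = Σ (−1)ʲ (face) ⊗ (β at the face)`; a
  twisted cycle is an element of `ker ∂_ω`, and its pairing with the holomorphic `2`-form
  `η = κ f^{s−1} de₁ ∧ de₂` (`κ = ζ − ζ² = i√3`) is the period. Here a branch on a set `S` along a
  map `φ : S → U` is a continuous `β` with `β^q = (f ∘ φ)^{a−q}` for `s = a/q` in lowest terms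
  (`KZ.IsBranchOn`), the cells are squares `(0,1)² → ℝ⁴` (`KZ.Cycle2`) carrying the integrand
  density `h = κ · β · jac2 φ` of `φ^* η` (`KZ.jac2` = the coefficient of `φ^*(de₁ ∧ de₂)` on
  `du ∧ dv`), the loads of the open edges are the boundary values of `β` (`Cycle2.b`), and the cycle
  condition (`KZ.Cycle2.IsClosed`) is the vanishing, at every point of `U` and every edge parameter,
  of the signed loads of the edges through that point — a sufficient, cell-by-cell checkable form of
  `∂_ω = 0` relative to `D = {f = 0}` (edges inside `D` carry no condition).
* **Stokes on loaded cubes** [Kontsevich–Zagier 2001, §1.2, rule 3)]: a `3`-cell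
  `Φ : (0,1)³ → U` loaded with a branch `β` carries the closed `2`-form
  `Φ^*(β η) = Σᵢ Cᵢ dx₀ ∧ ⋯ \widehat{dxᵢ} ⋯ ∧ dx₂`, `Cᵢ = κ · β · minor3 Φ i` (`KZ.minor3`,
  `KZ.IsLoadedCube`); closedness reads `Σᵢ (−1)ⁱ ∂ᵢ Cᵢ = 0` and Stokes' formula on the unit cube
  reads `∫_{(0,1)²} Σᵢ (−1)ⁱ (Cᵢ(xᵢ = 1) − Cᵢ(xᵢ = 0)) = 0` (`KZ.faceSum3`), under the regularity
  recorded in `KZ.IsStokesRegular` (the hypotheses of the tree's crux `CobordismMove.CubeStokes`,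
  item `stmt-KontsevichZagierPeriods-5566`, for complex-valued coefficients, with an exceptional
  null set `E` of base points). `KZ.Chain3` bundles finitely many such cubes with multiplicities.

## Main definitions

* (V1) `KZ.ζ`, `KZ.κ`, `KZ.eis`, `KZ.sLine`, `KZ.fArr`, `KZ.U`;
* (V2) `KZ.dEis`, `KZ.cdet`, `KZ.jac2`, `KZ.minor3`, `KZ.IsBranchOn`;
* (V3) `KZ.Cycle2`, `KZ.Cycle2.IsLoaded`, `KZ.Cycle2.IsClosed`, `KZ.Cycle2.total`,
  `KZ.Cycle2.period`;
* (V4) `KZ.Chain3`, `KZ.band`, `KZ.facePt`, `KZ.ReImSemialgebraicOn`, `KZ.IsStokesRegular`,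
  `KZ.IsLoadedCube`, `KZ.Chain3.IsStokes`, `KZ.Chain3.IsLoaded`, `KZ.faceSum3`, `KZ.Chain3.faceSum`,
  `KZ.Chain3.Bounds`.

## Main statements (all proved; small API)

* `KZ.zeta_sq_add_zeta_add_one`, `KZ.zeta_pow_three`, `KZ.kappa_eq`, `KZ.kappa_sq`;
  `KZ.fArr_eq_prod_sLine` (`f = s₀ s₁ s₂`); `KZ.continuous_eis`, `KZ.continuous_fArr`,
  `KZ.isOpen_U`;
* `KZ.facePt_mem_band`, `KZ.facePt_mem_openUnitCube`; unfolding lemmas `KZ.mem_U`,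
  `KZ.mem_band`, `KZ.faceSum3_apply`, `KZ.Chain3.faceSum_apply`, `KZ.Cycle2.total_apply`;
* `KZ.Cycle2.IsLoaded.integrableOn_total`, `KZ.Cycle2.IsLoaded.reImSemialgebraicOn_total`: the
  total integrand of a loaded cycle is integrable on the open square with `ℚ`-semialgebraic real
  and imaginary parts, i.e. its real and imaginary parts are integrands of `KZ.IntegralRep 2`'s.

## References

* N. Otsubo, T. Yamazaki, *Motivic Gauss and Jacobi sums*, Ann. Fac. Sci. Toulouse Math. (6) 35
  (2026), 95–135 (arXiv:2402.06072), §7.2, proof of Thm. 7.2 (the hyperplane `S`, the covering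
  `C^{n−1} → T`, `sᵢ = ∏ⱼ (1 − ζⁱ yⱼ)`). [`OtsuboYamazaki2026`]
* T. Terasoma, *Multiplication formula for hypergeometric functions*, in: Algebraic cycles and
  related topics (Kitasakado, 1994), World Scientific (1995), 83–91. [`Terasoma1995`]
* K. Aomoto, M. Kita, *Theory of Hypergeometric Functions*, Springer (2011), §2.1.5–§2.1.7
  (rank-one local system `ℒ_ω` of branches of `U = ∏ P_j^{α_j}`, twisted chains `Δ ⊗ U_Δ`,
  `∂_ω`, twisted cycles, locally finite version). [`AomotoKita2011`]
* M. Kontsevich, D. Zagier, *Periods*, in: Mathematics Unlimited — 2001 and Beyond, Springer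
  (2001), 771–808, §1.2 (rules 1)–3); "replaces the Newton–Leibniz formula by Stokes's formula
  in rule 3)"). [`KontsevichZagierPeriods2001`]

## Design notes

* ROUTE-POSITED NOTION. What is in print is the arrangement (Terasoma, Otsubo–Yamazaki), the
  notion of loaded/twisted chain and cycle (Aomoto–Kita) and Stokes' formula as a move
  (Kontsevich–Zagier); the particular cubical, semialgebraic, `(Re, Im)`-friendly packaging
  (`Cycle2`, `Chain3`, the pointwise cycle condition, the exceptional base set `E`) is the route
  line's, reconstructed from the §V1–§V4 block of its checked skeleton. The docstrings say which.
* Cells are maps of the OPEN unit cube `openUnitCube k = {x | ∀ i, x i ∈ Ioo 0 1}` of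
  `NashCubes.lean` (the skeleton's `cube k`; `KZ.cube` of `KZCubicalCalculus.lean` is the CLOSED
  cube and is not used here); closed-cube conditions are written `Set.Icc 0 1` as in `CubeStokes`.
* Complex-valued integrands are carried as `(Re, Im)` pairs of `ℚ`-semialgebraic real functions
  (`KZ.ReImSemialgebraicOn`, the conjunction consumed and produced by the `re_im_*` lemmas of
  `KZSemialgebraicComplex.lean`); `κ`, `ζ` have algebraic real and imaginary parts.
* The problem-specific objects of the line (§V5 of the skeleton: the bent square `quarterMap`,
  `triMap`, the cycle `Z₀ s`, …) mention the crux's integrands and stay on the summit side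
  (`Theorems/…Defs.lean`); nothing here depends on them.
* Nothing is asserted: every declaration is a definition with a body or a proved lemma (D-0014);
  in particular no Stokes theorem, no twisted-homology computation and no period identity is
  claimed here.
-/

noncomputable section

open Set Filter MeasureTheory
open scoped Topology
open Literature.ModelTheory.ExponentialFields (IsSemialgebraic isSemialgebraic_setOf_eval_nonneg
  isSemialgebraic_setOf_eval_pos)

namespace Literature.NumberTheory.Transcendental

namespace KZ

/-! ### (V1) Eisenstein coordinates and Terasoma's three lines -/

/-- The primitive cube root of unity `ζ = e^{2πi/3} = −1/2 + (√3/2) i`, written with real-algebraic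
coordinates. [folklore] -/
def ζ : ℂ := ⟨-1 / 2, Real.sqrt 3 / 2⟩

/-- The constant `κ = ζ − ζ² = i√3` in front of the form `η = κ (s₀s₁s₂)^{s−1} de₁ ∧ de₂` of the
line (`KZ.kappa_eq`, `KZ.kappa_sq`). [folklore] -/
def κ : ℂ := ζ - ζ ^ 2

/-- `Re ζ = −1/2`. [folklore] -/
@[simp] theorem zeta_re : ζ.re = -1 / 2 := rfl

/-- `Im ζ = √3/2`. [folklore] -/
@[simp] theorem zeta_im : ζ.im = Real.sqrt 3 / 2 := rfl

/-- `ζ² + ζ + 1 = 0`. [folklore] -/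
theorem zeta_sq_add_zeta_add_one : ζ ^ 2 + ζ + 1 = 0 := by
  have h3 : Real.sqrt 3 * Real.sqrt 3 = 3 := Real.mul_self_sqrt (by norm_num)
  apply Complex.ext
  · simp only [sq, Complex.add_re, Complex.mul_re, zeta_re, zeta_im, Complex.one_re,
      Complex.zero_re]
    nlinarith [h3]
  · simp only [sq, Complex.add_im, Complex.mul_im, zeta_re, zeta_im, Complex.one_im,
      Complex.zero_im]
    ring

/-- `ζ³ = 1`. [folklore] -/
theorem zeta_pow_three : ζ ^ 3 = 1 := by
  linear_combination (ζ - 1) * zeta_sq_add_zeta_add_one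

/-- `ζ ≠ 1`, so `ζ` is a PRIMITIVE cube root of unity. [folklore] -/
theorem zeta_ne_one : ζ ≠ 1 := by
  intro h
  have := congrArg Complex.re h
  simp only [zeta_re, Complex.one_re] at this
  norm_num at this

/-- `κ = i√3`. [folklore] -/
theorem kappa_eq : κ = ⟨0, Real.sqrt 3⟩ := by
  have h3 : Real.sqrt 3 * Real.sqrt 3 = 3 := Real.mul_self_sqrt (by norm_num)
  apply Complex.ext
  · simp only [κ, sq, Complex.sub_re, Complex.mul_re, zeta_re, zeta_im]
    nlinarith [h3]
  · simp only [κ, sq, Complex.sub_im, Complex.mul_im, zeta_re, zeta_im]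
    ring

/-- `κ² = −3`. [folklore] -/
theorem kappa_sq : κ ^ 2 = -3 := by
  unfold κ
  linear_combination (ζ ^ 2 - 3 * ζ + 3) * zeta_sq_add_zeta_add_one

/-- `κ ≠ 0`. [folklore] -/
theorem kappa_ne_zero : κ ≠ 0 := by
  intro h
  have h' := kappa_sq
  rw [h] at h'
  norm_num at h'

/-- **Eisenstein coordinates** on `ℂ² ≅ ℝ⁴`: the point of `ℂ²` with real coordinates `p` is
`(e₁, e₂) = (p₀ + ζ p₁, p₂ + ζ p₃)` (coordinates with respect to the basis `{1, ζ}` of `ℤ[ζ]`,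
so that `ℚ(ζ)`-linear maps are `ℚ`-polynomial in `p`). Route-posited packaging of the
coordinates `(e₁, e₂)` of `Sym² 𝔸¹` in which Terasoma's lines are linear.
[cite: OtsuboYamazaki2026, §7.2, proof of Thm. 7.2] -/
def eis (p : Fin 4 → ℝ) : ℂ × ℂ := ((p 0 : ℂ) + ζ * p 1, (p 2 : ℂ) + ζ * p 3)

/-- **Terasoma's three generic lines** `s_j = 1 − ζʲ e₁ + ζ²ʲ e₂` (`j = 0, 1, 2`) in the plane of
elementary symmetric functions `e₁ = y₁ + y₂`, `e₂ = y₁y₂`: `s_j = (1 − ζʲ y₁)(1 − ζʲ y₂)`, the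
`n = 3` case of `sᵢ = ∏ⱼ (1 − ζⁱ yⱼ)`. [cite: OtsuboYamazaki2026, §7.2, proof of Thm. 7.2] -/
def sLine (j : Fin 3) (p : Fin 4 → ℝ) : ℂ :=
  1 - ζ ^ (j : ℕ) * (eis p).1 + ζ ^ (2 * (j : ℕ)) * (eis p).2

/-- **The arrangement polynomial** `f = 1 − e₁³ + 3 e₁ e₂ + e₂³ = s₀ s₁ s₂`
(`= (1 − y₁³)(1 − y₂³)` upstairs; `KZ.fArr_eq_prod_sLine`), whose complex power `f^{s−1}` is the
multivalued factor of the form `η`. [cite: OtsuboYamazaki2026, §7.2, proof of Thm. 7.2] -/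
def fArr (p : Fin 4 → ℝ) : ℂ :=
  1 - (eis p).1 ^ 3 + 3 * (eis p).1 * (eis p).2 + (eis p).2 ^ 3

/-- **The complement `U = {s₀ s₁ s₂ ≠ 0}`** of Terasoma's three lines, as a subset of `ℝ⁴ ≅ ℂ²`
(the space on which the rank-one local systems of branches of `f^{s−1}` live).
[cite: OtsuboYamazaki2026, §7.2, proof of Thm. 7.2] -/
def U : Set (Fin 4 → ℝ) := {p | fArr p ≠ 0}

/-- Membership in `U` (definitional unfolding). [folklore] -/
theorem mem_U {p : Fin 4 → ℝ} : p ∈ U ↔ fArr p ≠ 0 := Iff.rfl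

/-- `f = s₀ s₁ s₂`: the arrangement polynomial is the product of Terasoma's three lines (uses only
`ζ² + ζ + 1 = 0`). [cite: OtsuboYamazaki2026, §7.2, proof of Thm. 7.2] -/
theorem fArr_eq_prod_sLine (p : Fin 4 → ℝ) : fArr p = ∏ j : Fin 3, sLine j p := by
  rw [Fin.prod_univ_three]
  simp only [sLine, fArr, Fin.val_zero, Fin.val_one, Fin.val_two, pow_zero, one_mul, mul_zero,
    mul_one, pow_one]
  set a := (eis p).1
  set b := (eis p).2
  linear_combination (-(b - b ^ 3 - a - 3 * a * b + a ^ 3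
    + ζ * (-b + b ^ 3 + 2 * a * b + a ^ 2 - a ^ 3) + ζ ^ 2 * (b + b ^ 2 - a * b)
    + ζ ^ 3 * (-b ^ 2 - b ^ 3 - a * b + a ^ 2 * b)
    + ζ ^ 4 * (b ^ 2 + b ^ 3 - a * b ^ 2))) * zeta_sq_add_zeta_add_one

/-- The Eisenstein coordinate map is continuous. [folklore] -/
@[fun_prop] theorem continuous_eis : Continuous eis := by
  unfold eis
  fun_prop

/-- The arrangement polynomial is continuous. [folklore] -/
@[fun_prop] theorem continuous_fArr : Continuous fArr := by
  unfold fArr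
  fun_prop

/-- The line `s_j` is a continuous function. [folklore] -/
@[fun_prop] theorem continuous_sLine (j : Fin 3) : Continuous (sLine j) := by
  unfold sLine
  fun_prop

/-- `U` is open. [folklore] -/
theorem isOpen_U : IsOpen U := isOpen_ne_fun continuous_fArr continuous_const

/-! ### (V2) Pull-backs of `de₁ ∧ de₂` and branches of `f^{s−1}` -/

/-- The `i`-th partial derivative of a map `Φ : ℝᵏ → ℝ⁴ ≅ ℂ²`, read in Eisenstein coordinates:
`(∂ᵢ e₁, ∂ᵢ e₂) ∈ ℂ²` (`eis` is `ℝ`-linear, so this is the derivative of `eis ∘ Φ`; Mathlib's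
`fderiv`, junk `0` where `Φ` is not differentiable). [folklore] -/
def dEis {k : ℕ} (Φ : (Fin k → ℝ) → (Fin 4 → ℝ)) (i : Fin k) (x : Fin k → ℝ) : ℂ × ℂ :=
  eis (fderiv ℝ Φ x (Pi.single i 1))

/-- The `2 × 2` complex determinant `a₁ b₂ − a₂ b₁` of two vectors of `ℂ²` (the value of
`de₁ ∧ de₂` on them). [folklore] -/
def cdet (a b : ℂ × ℂ) : ℂ := a.1 * b.2 - a.2 * b.1

/-- For a `2`-cell `φ : ℝ² → ℝ⁴ ≅ ℂ²`: the coefficient of `φ^*(de₁ ∧ de₂)` on `du ∧ dv`,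
`jac2 φ y = ∂ᵤe₁ ∂ᵥe₂ − ∂ᵥe₁ ∂ᵤe₂` at `y = (u, v)`. [folklore] -/
def jac2 (φ : (Fin 2 → ℝ) → (Fin 4 → ℝ)) (y : Fin 2 → ℝ) : ℂ := cdet (dEis φ 0 y) (dEis φ 1 y)

/-- For a `3`-cell `Φ : ℝ³ → ℝ⁴ ≅ ℂ²`: the coefficient of `Φ^*(de₁ ∧ de₂)` on
`dx₀ ∧ ⋯ \widehat{dxᵢ} ⋯ ∧ dx₂` (unsigned basis: `dx₁ ∧ dx₂`, `dx₀ ∧ dx₂`, `dx₀ ∧ dx₁` for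
`i = 0, 1, 2`), i.e. the minor of `(∂ⱼ e)` on the two indices `j ≠ i` in increasing order
(`Fin.succAbove`). With this basis `d(Σᵢ Cᵢ dx_{î}) = Σᵢ (−1)ⁱ ∂ᵢCᵢ dx₀ ∧ dx₁ ∧ dx₂`, the sign
convention of `CobordismMove.CubeStokes`. [folklore] -/
def minor3 (Φ : (Fin 3 → ℝ) → (Fin 4 → ℝ)) (i : Fin 3) (x : Fin 3 → ℝ) : ℂ :=
  cdet (dEis Φ (i.succAbove 0) x) (dEis Φ (i.succAbove 1) x)

/-- **A continuous branch of `(f ∘ φ)^{s−1}` on `S`** (a local section, along `φ`, of the rank-one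
local system `ℒ_s` of branches of `f^{s−1}` on `U`): `φ` maps `S` into `U`, `β` is continuous on
`S`, and `β^q = (f ∘ φ)^{a − q}` on `S` where `s = a/q` in lowest terms (`Rat.num`, `Rat.den`), so
that `β` is one of the `q` continuous determinations of `(f ∘ φ)^{s−1} = (f ∘ φ)^{(a−q)/q}`.
[cite: AomotoKita2011, §2.1.5, pp. 25–26] -/
def IsBranchOn {k : ℕ} (s : ℚ) (φ : (Fin k → ℝ) → (Fin 4 → ℝ)) (β : (Fin k → ℝ) → ℂ)
    (S : Set (Fin k → ℝ)) : Prop :=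
  MapsTo φ S U ∧ ContinuousOn β S ∧ ∀ x ∈ S, β x ^ s.den = fArr (φ x) ^ (s.num - (s.den : ℤ))

/-! ### Complex-valued semialgebraic functions, faces, bands -/

/-- A complex-valued function on `S ⊆ ℝᵐ` is carried by the Kontsevich–Zagier calculus over `ℚ` as
the `(Re, Im)` pair of its parts: both are `ℚ`-semialgebraic functions on `S` (the conjunction
consumed and produced by the `re_im_*` lemmas of `KZSemialgebraicComplex.lean`).
[cite: KontsevichZagierPeriods2001, §1.1] -/
abbrev ReImSemialgebraicOn {m : ℕ} (S : Set (Fin m → ℝ)) (F : (Fin m → ℝ) → ℂ) : Prop :=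
  IsSemialgebraicFunOn ℚ S (fun x => (F x).re) ∧ IsSemialgebraicFunOn ℚ S (fun x => (F x).im)

/-- **Face points**: insert the value `σ` as `i`-th coordinate, `facePt i σ y = Fin.insertNth i σ y`
(for `σ = 0, 1` the faces `{xᵢ = σ}` of the unit cube, as in `CobordismMove.CubeStokes`; for
`σ = t ∈ [0,1]` the segment across the cube in direction `i` over the base point `y`). [folklore] -/
def facePt {n : ℕ} (i : Fin (n + 1)) (σ : ℝ) (y : Fin n → ℝ) : Fin (n + 1) → ℝ :=
  Fin.insertNth i σ y

/-- The inserted coordinate of a face point. [folklore] -/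
@[simp] theorem facePt_apply_same {n : ℕ} (i : Fin (n + 1)) (σ : ℝ) (y : Fin n → ℝ) :
    facePt i σ y i = σ := by simp [facePt]

/-- The remaining coordinates of a face point. [folklore] -/
@[simp] theorem facePt_apply_succAbove {n : ℕ} (i : Fin (n + 1)) (σ : ℝ) (y : Fin n → ℝ)
    (j : Fin n) : facePt i σ y (i.succAbove j) = y j := by simp [facePt]

/-- **The band in direction `i`** of the unit `3`-cube: `xᵢ ∈ [0,1]` and `xⱼ ∈ (0,1)` for `j ≠ i`
— the union of the segments `t ↦ facePt i t y`, `t ∈ [0,1]`, over base points `y` of the open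
square; the set on which the `i`-th coefficient of a Stokes datum must make sense up to the two
faces `xᵢ = 0, 1`. [folklore] -/
def band (i : Fin 3) : Set (Fin 3 → ℝ) :=
  {x | x i ∈ Icc (0 : ℝ) 1 ∧ ∀ j, j ≠ i → x j ∈ Ioo (0 : ℝ) 1}

/-- Membership in a band (definitional unfolding). [folklore] -/
theorem mem_band {i : Fin 3} {x : Fin 3 → ℝ} :
    x ∈ band i ↔ x i ∈ Icc (0 : ℝ) 1 ∧ ∀ j, j ≠ i → x j ∈ Ioo (0 : ℝ) 1 := Iff.rfl

/-- The segment over a base point of the open square lies in the band. [folklore] -/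
theorem facePt_mem_band {i : Fin 3} {t : ℝ} {y : Fin 2 → ℝ} (ht : t ∈ Icc (0 : ℝ) 1)
    (hy : y ∈ openUnitCube 2) : facePt i t y ∈ band i := by
  refine ⟨by simpa using ht, fun j hj => ?_⟩
  obtain ⟨j', rfl⟩ := Fin.exists_succAbove_eq hj
  simpa using hy j'

/-- Interior points of the segment over a base point of the open square lie in the open cube.
[folklore] -/
theorem facePt_mem_openUnitCube {n : ℕ} {i : Fin (n + 1)} {t : ℝ} {y : Fin n → ℝ}
    (ht : t ∈ Ioo (0 : ℝ) 1) (hy : y ∈ openUnitCube n) : facePt i t y ∈ openUnitCube (n + 1) := by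
  refine mem_openUnitCube_iff.mpr fun j => ?_
  refine Fin.succAboveCases i ?_ (fun j' => ?_) j
  · simpa using ht
  · simpa using hy j'

/-- The band in direction `i` lies in the closed unit cube. [folklore] -/
theorem band_subset_Icc (i : Fin 3) : band i ⊆ Icc (0 : Fin 3 → ℝ) 1 := by
  intro x hx
  simp only [mem_Icc, Pi.le_def, Pi.zero_apply, Pi.one_apply]
  refine ⟨fun j => ?_, fun j => ?_⟩
  · by_cases hj : j = i
    · subst hj; exact hx.1.1
    · exact (hx.2 j hj).1.le
  · by_cases hj : j = i
    · subst hj; exact hx.1.2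
    · exact (hx.2 j hj).2.le

/-- Bands are `ℚ`-semialgebraic (`0 ≤ xᵢ ≤ 1`, `0 < xⱼ < 1`). [folklore] -/
theorem isSemialgebraic_band (i : Fin 3) : IsSemialgebraic ℚ (band i) := by
  have h : band i =
      ({x : Fin 3 → ℝ | 0 ≤ MvPolynomial.aeval x (MvPolynomial.X i : MvPolynomial (Fin 3) ℚ)} ∩
        {x | 0 ≤ MvPolynomial.aeval x (1 - MvPolynomial.X i : MvPolynomial (Fin 3) ℚ)}) ∩
      ⋂ j ∈ (Finset.univ.filter fun j => j ≠ i : Finset (Fin 3)),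
        ({x : Fin 3 → ℝ | 0 < MvPolynomial.aeval x (MvPolynomial.X j : MvPolynomial (Fin 3) ℚ)} ∩
          {x | 0 < MvPolynomial.aeval x (1 - MvPolynomial.X j : MvPolynomial (Fin 3) ℚ)}) := by
    ext x
    simp only [mem_band, mem_Icc, mem_Ioo, mem_inter_iff, mem_setOf_eq, mem_iInter,
      Finset.mem_filter, Finset.mem_univ, true_and, MvPolynomial.aeval_X, map_sub, map_one,
      sub_nonneg, sub_pos]
  rw [h]
  exact ((isSemialgebraic_setOf_eval_nonneg _).inter (isSemialgebraic_setOf_eval_nonneg _)).inter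
    (IsSemialgebraic.biInter _ _ fun j _ =>
      (isSemialgebraic_setOf_eval_pos _).inter (isSemialgebraic_setOf_eval_pos _))

/-- The open unit cube lies in every band. [folklore] -/
theorem openUnitCube_subset_band (i : Fin 3) : openUnitCube 3 ⊆ band i := fun _ hx =>
  ⟨Ioo_subset_Icc_self (hx i), fun j _ => hx j⟩

/-! ### (V3) Loaded `2`-cycles -/

/-- **A loaded cubical `2`-chain in `ℂ² ≅ ℝ⁴`** (data only; the conditions are `Cycle2.IsLoaded`,
`Cycle2.IsClosed`): `M` square cells `φ j : ℝ² → ℝ⁴` with integer multiplicities `n j`, each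
loaded with a function `β j` (to be a branch of `(f ∘ φ j)^{s−1}` on the open square), an integrand
density `h j` (to be `κ · β j · jac2 (φ j)`, the density of `(φ j)^* (β η)`), and edge loads
`b j i σ : ℝ → ℂ` on the four open edges `{yᵢ = σ}`, `σ = 0, 1` (to be the boundary values of
`β j`). Route-posited packaging of the twisted chains `Σ c_Δ Δ ⊗ U_Δ` of Aomoto–Kita.
[cite: AomotoKita2011, §2.1.6] -/
structure Cycle2 where
  /-- number of cells -/
  M : ℕ
  /-- integer multiplicities -/
  n : Fin M → ℤ
  /-- the cells, maps of the (open) unit square into `ℝ⁴ ≅ ℂ²` -/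
  φ : Fin M → (Fin 2 → ℝ) → (Fin 4 → ℝ)
  /-- the loads: a branch of `(f ∘ φ j)^{s−1}` on the open square -/
  β : Fin M → (Fin 2 → ℝ) → ℂ
  /-- the integrand densities of `(φ j)^*(β η)` on the open square -/
  h : Fin M → (Fin 2 → ℝ) → ℂ
  /-- the edge loads: `b j i σ t` = boundary value of `β j` at the point `facePt i σ t` of the
  open edge `{yᵢ = σ}`, `t ∈ (0,1)` -/
  b : Fin M → Fin 2 → Fin 2 → ℝ → ℂ

namespace Cycle2

/-- **Loaded for the exponent `s`**: every cell is a `ℚ`-polynomial map; on the open square it maps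
into `U` and `β j` is a continuous branch of `(f ∘ φ j)^{s−1}` there; the density is
`h j = κ · β j · jac2 (φ j)` pointwise on the open square, absolutely integrable there, with
`ℚ`-semialgebraic real and imaginary parts (so that `[(0,1)², Re h j]`, `[(0,1)², Im h j]` are
integral representations of the calculus); and each open edge `t ↦ facePt i σ t`, `t ∈ (0,1)`,
either maps into `U`, with `b j i σ t` the limit of `β j` from within the open square, or maps into
the divisor `D = {f = 0}` (no condition: the chain is taken relative to `D`).
[cite: AomotoKita2011, §2.1.6–§2.1.7] -/
def IsLoaded (s : ℚ) (Z : Cycle2) : Prop :=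
  ∀ j : Fin Z.M,
    (∃ P : Fin 4 → MvPolynomial (Fin 2) ℚ, ∀ y k, Z.φ j y k = MvPolynomial.aeval y (P k)) ∧
    IsBranchOn s (Z.φ j) (Z.β j) (openUnitCube 2) ∧
    (∀ y ∈ openUnitCube 2, Z.h j y = κ * Z.β j y * jac2 (Z.φ j) y) ∧
    IntegrableOn (Z.h j) (openUnitCube 2) ∧
    ReImSemialgebraicOn (openUnitCube 2) (Z.h j) ∧
    (∀ (i σ : Fin 2),
      (∀ t ∈ Ioo (0 : ℝ) 1,
          Z.φ j (facePt i ((σ : ℕ) : ℝ) (fun _ => t)) ∈ U ∧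
          Tendsto (Z.β j) (𝓝[openUnitCube 2] (facePt i ((σ : ℕ) : ℝ) (fun _ => t)))
            (𝓝 (Z.b j i σ t))) ∨
      (∀ t ∈ Ioo (0 : ℝ) 1, Z.φ j (facePt i ((σ : ℕ) : ℝ) (fun _ => t)) ∉ U))

open Classical in
/-- **Closed (a twisted cycle relative to `D`)**: for every edge parameter `t ∈ (0,1)` and every
point `p` of `U`, the signed loads `(−1)^{i+σ} · n j · b j i σ t` of all the edges `(j, i, σ)`
passing through `p` at parameter `t` add up to `0` — the vanishing of the twisted boundary
`∂_ω (Σ n_j φ_j ⊗ β_j) = Σ_j n_j Σ_{i,σ} (−1)^{i+σ} (φ_j ∘ face_{i,σ}) ⊗ (β_j at the face)` checked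
pointwise, edges inside `D` being discarded (signs: the boundary orientation of the faces
`{yᵢ = σ}` of the square, as in `CobordismMove.CubeStokes`). A sufficient, cell-by-cell checkable
form of the cycle condition; route-posited. [cite: AomotoKita2011, §2.1.6] -/
def IsClosed (Z : Cycle2) : Prop :=
  ∀ t ∈ Ioo (0 : ℝ) 1, ∀ p ∈ U,
    (∑ j : Fin Z.M, ∑ i : Fin 2, ∑ σ : Fin 2,
      if Z.φ j (facePt i ((σ : ℕ) : ℝ) (fun _ => t)) = p then
        (-1 : ℂ) ^ ((i : ℕ) + (σ : ℕ)) * (Z.n j : ℂ) * Z.b j i σ t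
      else 0) = 0

/-- **The total integrand** `Σ_j n_j · h_j` of a loaded `2`-chain on the unit square (all cells are
parametrised by the same square, so the period is one integral). [folklore] -/
def total (Z : Cycle2) (y : Fin 2 → ℝ) : ℂ := ∑ j : Fin Z.M, (Z.n j : ℂ) * Z.h j y

/-- Unfolding of `Cycle2.total`. [folklore] -/
theorem total_apply (Z : Cycle2) (y : Fin 2 → ℝ) :
    Z.total y = ∑ j : Fin Z.M, (Z.n j : ℂ) * Z.h j y := rfl

/-- **The period** `∫_{(0,1)²} Σ_j n_j h_j = Σ_j n_j ∫_{φ_j} β_j η` of a loaded `2`-chain: the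
pairing of the twisted chain with the form `η = κ f^{s−1} de₁ ∧ de₂`.
[cite: AomotoKita2011, §2.1.7] -/
def period (Z : Cycle2) : ℂ := ∫ y in openUnitCube 2, Z.total y

/-- The total integrand of a loaded chain is absolutely integrable on the open square. [folklore] -/
theorem IsLoaded.integrableOn_total {s : ℚ} {Z : Cycle2} (hZ : Z.IsLoaded s) :
    IntegrableOn Z.total (openUnitCube 2) := by
  have : Z.total = fun y => ∑ j : Fin Z.M, (Z.n j : ℂ) * Z.h j y := rfl
  rw [this]
  exact integrable_finsetSum Finset.univ fun j _ => (hZ j).2.2.2.1.const_mul _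

/-- The total integrand of a loaded chain has `ℚ`-semialgebraic real and imaginary parts on the
open square (so `[(0,1)², Re total]` and `[(0,1)², Im total]` are `KZ.IntegralRep 2`'s).
[cite: KontsevichZagierPeriods2001, §1.1] -/
theorem IsLoaded.reImSemialgebraicOn_total {s : ℚ} {Z : Cycle2} (hZ : Z.IsLoaded s) :
    ReImSemialgebraicOn (openUnitCube 2) Z.total := by
  have hsq : IsSemialgebraic ℚ (openUnitCube 2) := isSemialgebraic_openUnitCube
  have key : ∀ F : Finset (Fin Z.M),
      ReImSemialgebraicOn (openUnitCube 2) fun y => ∑ j ∈ F, (Z.n j : ℂ) * Z.h j y := by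
    intro F
    induction F using Finset.induction_on with
    | empty =>
      have hfun : (fun y : Fin 2 → ℝ => ∑ j ∈ (∅ : Finset (Fin Z.M)), (Z.n j : ℂ) * Z.h j y) =
          fun _ => (0 : ℂ) := by
        funext y; exact Finset.sum_empty
      rw [hfun]
      exact re_im_const hsq (c := 0) (by simpa using isAlgebraic_zero)
        (by simpa using isAlgebraic_zero)
    | @insert j F hj ih =>
      have hterm : ReImSemialgebraicOn (openUnitCube 2) fun y => (Z.n j : ℂ) * Z.h j y :=
        re_im_mul (re_im_const hsq (c := (Z.n j : ℂ))
          (by simpa using isAlgebraic_int (R := ℚ) (A := ℝ) (Z.n j))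
          (by simpa using isAlgebraic_zero)) (hZ j).2.2.2.2.1
      have hfun : (fun y : Fin 2 → ℝ => ∑ j' ∈ insert j F, (Z.n j' : ℂ) * Z.h j' y) =
          fun y => (Z.n j : ℂ) * Z.h j y + ∑ j' ∈ F, (Z.n j' : ℂ) * Z.h j' y := by
        funext y; exact Finset.sum_insert hj
      rw [hfun]
      exact re_im_add hterm ih
  exact key Finset.univ

end Cycle2

/-! ### (V4) Loaded `3`-chains and cubical Stokes data -/

/-- **A loaded cubical `3`-chain in `ℂ² ≅ ℝ⁴`** (data only; the conditions are `Chain3.IsStokes`,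
`Chain3.IsLoaded`): `N` cube cells `Φ j : ℝ³ → ℝ⁴` with integer multiplicities `n j`, loads `β j`
(branches of `(f ∘ Φ j)^{s−1}`), the three coefficient functions `C j i` of the pulled-back
`2`-form `(Φ j)^*(β η) = Σᵢ C j i dx₀ ∧ ⋯ \widehat{dxᵢ} ⋯ ∧ dx₂` and their partials
`C' j i = ∂ᵢ (C j i)`, and an exceptional set `E` of base points of the square (Lebesgue-null,
off which the coefficients are regular along the segments across the cube). Route-posited
packaging of the twisted `3`-chains whose boundaries move loaded `2`-cycles.
[cite: AomotoKita2011, §2.1.6] -/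
structure Chain3 where
  /-- number of cubes -/
  N : ℕ
  /-- integer multiplicities -/
  n : Fin N → ℤ
  /-- the cells, maps of the (open) unit cube into `ℝ⁴ ≅ ℂ²` -/
  Φ : Fin N → (Fin 3 → ℝ) → (Fin 4 → ℝ)
  /-- the loads: a branch of `(f ∘ Φ j)^{s−1}` on the open cube -/
  β : Fin N → (Fin 3 → ℝ) → ℂ
  /-- the coefficients `C j i` of `(Φ j)^*(β η)` on `dx₀ ∧ ⋯ \widehat{dxᵢ} ⋯ ∧ dx₂` -/
  C : Fin N → Fin 3 → (Fin 3 → ℝ) → ℂ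
  /-- the partial derivatives `C' j i = ∂ᵢ (C j i)` on the open cube -/
  C' : Fin N → Fin 3 → (Fin 3 → ℝ) → ℂ
  /-- exceptional (null) set of base points `y ∈ (0,1)²` -/
  E : Set (Fin 2 → ℝ)

/-- **Stokes-regular coefficient system on the unit `3`-cube** (the hypotheses of
`CobordismMove.CubeStokes`, item `stmt-KontsevichZagierPeriods-5566`, for complex-valued
coefficients and with an exceptional null set `E` of base points): each `C i` has
`ℚ`-semialgebraic real and imaginary parts on the band in direction `i`; for every base point
`y ∈ (0,1)² ∖ E` the segment function `t ↦ C i (facePt i t y)` is continuous on `[0,1]` and has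
derivative `C' i (facePt i t y)` at every `t ∈ (0,1)`; each `C' i` is absolutely integrable on the
open cube with `ℚ`-semialgebraic real and imaginary parts; and the form `Σᵢ Cᵢ dx_{î}` is CLOSED:
`Σᵢ (−1)ⁱ C' i = 0` on the open cube. Under these hypotheses Fubini and the fundamental theorem of
calculus give Stokes' formula `∫_{(0,1)²} faceSum3 C = 0` (not asserted here).
[cite: KontsevichZagierPeriods2001, §1.2] -/
def IsStokesRegular (E : Set (Fin 2 → ℝ)) (C C' : Fin 3 → (Fin 3 → ℝ) → ℂ) : Prop :=
  (∀ i, ReImSemialgebraicOn (band i) (C i)) ∧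
  (∀ i, ∀ y ∈ openUnitCube 2 \ E,
    ContinuousOn (fun τ : ℝ => C i (facePt i τ y)) (Icc 0 1) ∧
    ∀ t ∈ Ioo (0 : ℝ) 1, HasDerivAt (fun τ : ℝ => C i (facePt i τ y)) (C' i (facePt i t y)) t) ∧
  (∀ i, IntegrableOn (C' i) (openUnitCube 3) ∧ ReImSemialgebraicOn (openUnitCube 3) (C' i)) ∧
  (∀ x ∈ openUnitCube 3, ∑ i : Fin 3, (-1 : ℂ) ^ (i : ℕ) * C' i x = 0)

/-- **A loaded `3`-cube for the exponent `s`**: `Φ` is a `ℚ`-semialgebraic map on the open cube,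
continuous on the closed cube `[0,1]³`, differentiable at every point of the open cube, which it
maps into `U`; `β` is a continuous branch of `(f ∘ Φ)^{s−1}` on the open cube; and the coefficients
are those of `Φ^*(β η)`, `η = κ f^{s−1} de₁ ∧ de₂`: `C i = κ · β · minor3 Φ i` on the open cube.
[cite: AomotoKita2011, §2.1.6] -/
def IsLoadedCube (s : ℚ) (Φ : (Fin 3 → ℝ) → (Fin 4 → ℝ)) (β : (Fin 3 → ℝ) → ℂ)
    (C : Fin 3 → (Fin 3 → ℝ) → ℂ) : Prop :=
  IsSemialgebraicMapOn ℚ (openUnitCube 3) Φ ∧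
  ContinuousOn Φ (Icc 0 1) ∧
  (∀ x ∈ openUnitCube 3, DifferentiableAt ℝ Φ x) ∧
  IsBranchOn s Φ β (openUnitCube 3) ∧
  (∀ i, ∀ x ∈ openUnitCube 3, C i x = κ * β x * minor3 Φ i x)

namespace Chain3

/-- **Stokes data**: the exceptional base set is `ℚ`-semialgebraic and Lebesgue-null, and every
cube of the chain is a Stokes-regular coefficient system off it.
[cite: KontsevichZagierPeriods2001, §1.2] -/
def IsStokes (W : Chain3) : Prop :=
  IsSemialgebraic ℚ W.E ∧ volume W.E = 0 ∧ ∀ j : Fin W.N, IsStokesRegular W.E (W.C j) (W.C' j)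

/-- **Loaded for the exponent `s`**: every cube of the chain is a loaded `3`-cube whose
coefficients are those of `(Φ j)^*(β_j η)`. [cite: AomotoKita2011, §2.1.6] -/
def IsLoaded (s : ℚ) (W : Chain3) : Prop :=
  ∀ j : Fin W.N, IsLoadedCube s (W.Φ j) (W.β j) (W.C j)

end Chain3

/-- **The signed face sum of one cube** over a base point `y` of the square:
`Σᵢ (−1)ⁱ (Cᵢ(facePt i 1 y) − Cᵢ(facePt i 0 y))` — the integrand of `∫_{∂[0,1]³} Σᵢ Cᵢ dx_{î}`
written on the common base square (boundary orientation `(−1)^{i+σ}` of the face `{xᵢ = σ}`).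
[cite: KontsevichZagierPeriods2001, §1.2] -/
def faceSum3 (C : Fin 3 → (Fin 3 → ℝ) → ℂ) (y : Fin 2 → ℝ) : ℂ :=
  ∑ i : Fin 3, (-1 : ℂ) ^ (i : ℕ) * (C i (facePt i 1 y) - C i (facePt i 0 y))

/-- Unfolding of `faceSum3`. [folklore] -/
theorem faceSum3_apply (C : Fin 3 → (Fin 3 → ℝ) → ℂ) (y : Fin 2 → ℝ) :
    faceSum3 C y = ∑ i : Fin 3, (-1 : ℂ) ^ (i : ℕ) * (C i (facePt i 1 y) - C i (facePt i 0 y)) :=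
  rfl

/-- The double signed sum `Σᵢ Σ_σ (−1)^{i+σ} Cᵢ(facePt i σ y)` over the six faces — the sign
pattern of `CobordismMove.CubeStokes` — is the NEGATIVE of `faceSum3 C y` (immaterial for vanishing
statements and for membership in `KZ.relations`). [folklore] -/
theorem sum_sum_sign_face_eq_neg_faceSum3 (C : Fin 3 → (Fin 3 → ℝ) → ℂ) (y : Fin 2 → ℝ) :
    ∑ i : Fin 3, ∑ σ : Fin 2, (-1 : ℂ) ^ ((i : ℕ) + (σ : ℕ)) * C i (facePt i ((σ : ℕ) : ℝ) y) =
      -faceSum3 C y := by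
  simp only [faceSum3, ← Finset.sum_neg_distrib, Fin.sum_univ_two, Fin.val_zero, Fin.val_one,
    Nat.cast_zero, Nat.cast_one, add_zero, pow_succ, mul_neg, mul_one, neg_mul]
  refine Finset.sum_congr rfl fun i _ => ?_
  ring

namespace Chain3

/-- **The signed face sum of the chain**: `Σ_j n_j · faceSum3 (C j)`, the integrand on the base
square of `∫_{∂W} β η`. [cite: KontsevichZagierPeriods2001, §1.2] -/
def faceSum (W : Chain3) (y : Fin 2 → ℝ) : ℂ := ∑ j : Fin W.N, (W.n j : ℂ) * faceSum3 (W.C j) y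

/-- Unfolding of `Chain3.faceSum`. [folklore] -/
theorem faceSum_apply (W : Chain3) (y : Fin 2 → ℝ) :
    W.faceSum y = ∑ j : Fin W.N, (W.n j : ℂ) * faceSum3 (W.C j) y := rfl

/-- **`W` bounds `m · g`**: off the exceptional set, the signed face sum of the chain is `m` times
the density `g` pointwise on the open square — the integrand-level form of "`∂W = m · Z` modulo
faces inside `D` and cancelling faces" for a loaded `2`-chain with total density `g`, which with
Stokes (`∫ faceSum = 0`) yields `m · ∫ g = 0` or, split differently, the equality of two periods.
Route-posited. [cite: AomotoKita2011, §2.1.6] -/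
def Bounds (W : Chain3) (m : ℤ) (g : (Fin 2 → ℝ) → ℂ) : Prop :=
  ∀ y ∈ openUnitCube 2 \ W.E, W.faceSum y = (m : ℂ) * g y

end Chain3

end KZ

end Literature.NumberTheory.Transcendental
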